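import Summits.ValiantsHypothesis.ValiantsHypothesis.Theorems.KPlusLogSqLawTropicalBBlockRematch

/-!
# Route «KPlusLogSqLaw», crux `TropicalB` (stmt-ValiantsHypothesis-19771) — the DOUBLE-COUPLING WINDOW:
# two registers coupled both ways can carry a 2 × 2 product only if the hole-cell excess lies strictly between the two steps

HONEST FRAMING.  Helper toward the registered stubs `stub_tropThin` / `stub_tropFat` of `Cruxes/TropicalB/Lines/birth.lean` (crux
`Summit.ValiantsHypothesis.ValiantsHypothesis.Theses.KPlusLogSqLaw.TropicalB`, item stmt-ValiantsHypothesis-19771, route KPlusLogSqLaw;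
cell `pub-symmetroid`, seat val-sym-trop-p5 g15, refuter-adjacent lane, 2026-08-28; `--supports … --as helper`).  A STRUCTURE (no-go) law
about unique optima (`IsDominant`) of an ARBITRARY design, stated on four terms and four columns only; companion of the seat's
`…TropicalBTwoSignalLaw` (p624662), `…TropicalBCrossedExchange` (p625551), `…TropicalBBlockRematch` (p626632).  Nothing here bounds
`TropicalB`, and nothing bears on `WeakLifting`, DoorA26 / DoorA34, `MatrixDescartes` (stmt-ValiantsHypothesis-18050) or VP ≠ VNP.

THE SETTING (what a «double-coupled square» of two hole registers looks like column by column; cf. memo TWO-SIGNAL-g15.md §2b).  Four terms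
`T00, T01, T10, T11` (first index = slow register R1 in states x < y, second = fast register R2 in states u < v) and four distinct columns:
`k₁` = R1's column hole at x, `k₁'` at y, `k₂` = R2's column hole at u, `k₂'` at v.  Hypotheses (all equalities of CELLS `(row, class)`):
* every other column is an R1-column (`T01 = T00`, `T10 = T11` there), an R2-column (`T01 = T11`, `T10 = T00`) or common;
* CASE A («the later configuration contains the earlier hole cell»): at `k₁` the terms `T10, T11` carry the same cell, whose row is the row
  `T00` puts at `k₂` (= R1's row hole at x, coupled into R2's column hole); at `k₂` the terms `T01, T11` carry the same cell, whose row is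
  `T00.1 k₁` (= R2's row hole at u);
* couplings: at `k₁` the cells of `T00, T01` have the same (coupling) class; at `k₂` those of `T00, T10`; at `k₁'`, `T00 = T01` (cell) and
  `T10, T11` carry R2's row holes `T00.1 k₁`, `T01.1 k₁` with the class of `T00` at `k₁`; at `k₂'`, `T00 = T10` and `T01, T11` carry
  `T00.1 k₂`, `T10.1 k₂` with the class of `T00` at `k₂`;
* `T01` dominant at `θ₀₁`, `T10` dominant at `θ₁₀ > θ₀₁` (anti-diagonal order: R1 is the slow digit), `T00`, `T11` present, and the
  coupling row at `k₂'` differs from R2's own row there (`T00.1 k₂' ≠ T01.1 k₂'`).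
* `DoubleCoupling.window` — **THE DOUBLE-COUPLING WINDOW.**  Then, with `γ = (d(T10.2 k₁) − d(T00.2 k₁)) + (d(T01.2 k₂) − d(T00.2 k₂))` (the
  exponent excess of the two HOLE CELLS over the two COUPLING CELLS), `slope T01 − slope T00 < γ < slope T11 − slope T01`: the excess must lie
  STRICTLY BETWEEN the fast step and the slow step.  Proof: the CLOSED term `C` (= `T00` with the rows of `k₁`, `k₂` swapped: both registers
  closed by their own hole cells, no coupling) and the DOUBLE term `D` (= `T11` with the rows of `k₁ → k₁' → k₂ → k₂' → k₁` cycled: both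
  registers doubly holed, four couplings) are present and repackage `T01 + T10` column by column; val-sym-trop-p4's multi-exchange law
  `MultiExchange.prefix_deficit` (t = 2, both orders) gives `slope T01 < slope C = slope T00 + γ` and `slope T01 < slope D = slope T11 − γ`.
* `DoubleCoupling.nogo_coupling_class`, `DoubleCoupling.nogo_register_class` — the two natural costings are DEAD: hole cells of the coupling
  class (`γ = 0`), or hole cells of the registers' own classes when R1's class step is its slope step (`γ ≥ slope T11 − slope T01`).  These are
  exactly the seat's located squares (diagonal-hole / path / rotation registers, all LP-infeasible from 2 × 2 on), now dead in the kernel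
  for every valuation; a surviving double coupling needs hole cells of a THIRD class with intermediate exponent.
[folklore: LP duality / Abel summation (the multi-exchange law); the packaging («double-coupling window») is the cell's]
-/

set_option linter.dupNamespace false
set_option autoImplicit false

namespace Summit.ValiantsHypothesis.ValiantsHypothesis.Theorems.KPlusLogSqLaw

namespace DoubleCoupling

open Summit.ValiantsHypothesis.ValiantsHypothesis.Theorems.MatrixDescartes.Negative
open Summit.ValiantsHypothesis.ValiantsHypothesis.Theorems.LacunarySymmetroidMatrixDescartes
open Summit.ValiantsHypothesis.ValiantsHypothesis.Theorems.LacunarySymmetroidMatrixDescartes.TropicalCensus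
open Finset

variable {m K : ℕ}

/-- **THE DOUBLE-COUPLING WINDOW.**  See the module docstring. [folklore: multi-exchange law; packaging this cell] -/
theorem window (d : Fin K → ℕ) (v ε : Fin m → Fin m → Fin K → ℤ)
    (T00 T01 T10 T11 : Equiv.Perm (Fin m) × (Fin m → Fin K)) {θ₀₁ θ₁₀ : ℤ} (hθ : θ₀₁ < θ₁₀)
    (h01 : IsDominant d v ε θ₀₁ T01) (h10 : IsDominant d v ε θ₁₀ T10) (h00 : termSign ε T00 ≠ 0) (h11 : termSign ε T11 ≠ 0)
    (k₁ k₁' k₂ k₂' : Fin m) (h11' : k₁ ≠ k₁') (h12 : k₁ ≠ k₂) (h12' : k₁ ≠ k₂') (h1'2 : k₁' ≠ k₂) (h1'2' : k₁' ≠ k₂') (h22' : k₂ ≠ k₂')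
    -- generic columns follow one register (or both)
    (hcol : ∀ b, b ≠ k₁ → b ≠ k₁' → b ≠ k₂ → b ≠ k₂' →
      ((T01.1 b, T01.2 b) = (T00.1 b, T00.2 b) ∧ (T10.1 b, T10.2 b) = (T11.1 b, T11.2 b)) ∨
      ((T01.1 b, T01.2 b) = (T11.1 b, T11.2 b) ∧ (T10.1 b, T10.2 b) = (T00.1 b, T00.2 b)))
    -- column k₁ (R1's hole column at x): couplings for T00, T01 (same class); Case-A hole cell for T10 = T11 with row T00.1 k₂
    (hA1 : T10.1 k₁ = T00.1 k₂) (hA1' : (T11.1 k₁, T11.2 k₁) = (T10.1 k₁, T10.2 k₁)) (hc1 : T01.2 k₁ = T00.2 k₁)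
    -- column k₂ (R2's hole column at u): couplings for T00, T10; Case-A hole cell for T01 = T11 with row T00.1 k₁
    (hA2 : T01.1 k₂ = T00.1 k₁) (hA2' : (T11.1 k₂, T11.2 k₂) = (T01.1 k₂, T01.2 k₂)) (hc2 : T10.2 k₂ = T00.2 k₂)
    -- column k₁' (R1's hole column at y): T00 = T01 there; T10, T11 carry the couplings from R2's row holes
    (hB1 : (T01.1 k₁', T01.2 k₁') = (T00.1 k₁', T00.2 k₁')) (hB1a : T10.1 k₁' = T00.1 k₁) (hB1b : T11.1 k₁' = T01.1 k₁)
    (hB1c : T10.2 k₁' = T00.2 k₁) (hB1d : T11.2 k₁' = T00.2 k₁)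
    -- column k₂' (R2's hole column at v): T00 = T10 there; T01, T11 carry the couplings from R1's row holes
    (hB2 : (T10.1 k₂', T10.2 k₂') = (T00.1 k₂', T00.2 k₂')) (hB2a : T01.1 k₂' = T00.1 k₂) (hB2b : T11.1 k₂' = T10.1 k₂)
    (hB2c : T01.2 k₂' = T00.2 k₂) (hB2d : T11.2 k₂' = T00.2 k₂)
    (hdiff : T00.1 k₂' ≠ T01.1 k₂') :
    slope d T01 < slope d T00 + ((d (T10.2 k₁) : ℤ) - d (T00.2 k₁)) + ((d (T01.2 k₂) : ℤ) - d (T00.2 k₂)) ∧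
    slope d T01 < slope d T11 - (((d (T10.2 k₁) : ℤ) - d (T00.2 k₁)) + ((d (T01.2 k₂) : ℤ) - d (T00.2 k₂))) := by
  classical
  -- the CLOSED term: T00 with the rows of k₁ and k₂ swapped (cells (T00.1 k₂, k₁) = T10's hole cell, (T00.1 k₁, k₂) = T01's)
  let Cperm : Equiv.Perm (Fin m) := (Equiv.swap k₁ k₂).trans T00.1
  let Ccl : Fin m → Fin K := fun b => if b = k₁ then T10.2 k₁ else if b = k₂ then T01.2 k₂ else T00.2 b
  let C : Equiv.Perm (Fin m) × (Fin m → Fin K) := (Cperm, Ccl)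
  -- the DOUBLE term: T11 with the rows cycled k₁ ← k₁' ← k₂ ← k₂' ← k₁ (column b takes the row T11 puts at c b)
  let c : Equiv.Perm (Fin m) := (Equiv.swap k₂ k₂').trans ((Equiv.swap k₁' k₂).trans (Equiv.swap k₁ k₁'))
  let Dperm : Equiv.Perm (Fin m) := c.trans T11.1
  let Dcl : Fin m → Fin K := fun b =>
    if b = k₁ then T00.2 k₁ else if b = k₁' then T00.2 k₁ else if b = k₂ then T00.2 k₂ else if b = k₂' then T00.2 k₂ else T11.2 b
  let D : Equiv.Perm (Fin m) × (Fin m → Fin K) := (Dperm, Dcl)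
  -- values of the column permutations
  have hck₁ : c k₁ = k₁' := by
    simp only [c, Equiv.trans_apply]
    rw [Equiv.swap_apply_of_ne_of_ne h12 h12', Equiv.swap_apply_of_ne_of_ne h11' h12, Equiv.swap_apply_left]
  have hck₁' : c k₁' = k₂ := by
    simp only [c, Equiv.trans_apply]
    rw [Equiv.swap_apply_of_ne_of_ne h1'2 h1'2', Equiv.swap_apply_left, Equiv.swap_apply_of_ne_of_ne h12.symm h1'2.symm]
  have hck₂ : c k₂ = k₂' := by
    simp only [c, Equiv.trans_apply]
    rw [Equiv.swap_apply_left, Equiv.swap_apply_of_ne_of_ne h1'2'.symm h22'.symm, Equiv.swap_apply_of_ne_of_ne h12'.symm h1'2'.symm]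
  have hck₂' : c k₂' = k₁ := by
    simp only [c, Equiv.trans_apply]
    rw [Equiv.swap_apply_right, Equiv.swap_apply_right, Equiv.swap_apply_right]
  have hcb : ∀ b, b ≠ k₁ → b ≠ k₁' → b ≠ k₂ → b ≠ k₂' → c b = b := by
    intro b hb1 hb1' hb2 hb2'
    simp only [c, Equiv.trans_apply]
    rw [Equiv.swap_apply_of_ne_of_ne hb2 hb2', Equiv.swap_apply_of_ne_of_ne hb1' hb2, Equiv.swap_apply_of_ne_of_ne hb1 hb1']
  -- cells of C and D, column by column
  have Ck₁ : (C.1 k₁, C.2 k₁) = (T10.1 k₁, T10.2 k₁) := by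
    show (T00.1 (Equiv.swap k₁ k₂ k₁), Ccl k₁) = _
    rw [Equiv.swap_apply_left]; simp only [Ccl, if_true]; rw [hA1]
  have Ck₂ : (C.1 k₂, C.2 k₂) = (T01.1 k₂, T01.2 k₂) := by
    show (T00.1 (Equiv.swap k₁ k₂ k₂), Ccl k₂) = _
    rw [Equiv.swap_apply_right]; simp only [Ccl, if_neg h12.symm, if_true]; rw [hA2]
  have Cb : ∀ b, b ≠ k₁ → b ≠ k₂ → (C.1 b, C.2 b) = (T00.1 b, T00.2 b) := by
    intro b hb1 hb2
    show (T00.1 (Equiv.swap k₁ k₂ b), Ccl b) = _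
    rw [Equiv.swap_apply_of_ne_of_ne hb1 hb2]; simp only [Ccl, if_neg hb1, if_neg hb2]
  have Dk₁ : (D.1 k₁, D.2 k₁) = (T01.1 k₁, T01.2 k₁) := by
    show (T11.1 (c k₁), Dcl k₁) = _
    rw [hck₁, hB1b]; simp only [Dcl, if_true]; rw [hc1]
  have Dk₁' : (D.1 k₁', D.2 k₁') = (T10.1 k₁', T10.2 k₁') := by
    show (T11.1 (c k₁'), Dcl k₁') = _
    rw [hck₁', hB1a, hB1c]; simp only [Dcl, if_neg h11'.symm, if_true]
    rw [(Prod.mk.inj hA2').1, hA2]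
  have Dk₂ : (D.1 k₂, D.2 k₂) = (T10.1 k₂, T10.2 k₂) := by
    show (T11.1 (c k₂), Dcl k₂) = _
    rw [hck₂, hB2b, hc2]; simp only [Dcl, if_neg h12.symm, if_neg h1'2.symm, if_true]
  have Dk₂' : (D.1 k₂', D.2 k₂') = (T01.1 k₂', T01.2 k₂') := by
    show (T11.1 (c k₂'), Dcl k₂') = _
    rw [hck₂', hB2a, hB2c]; simp only [Dcl, if_neg h12'.symm, if_neg h1'2'.symm, if_neg h22'.symm, if_true]
    rw [(Prod.mk.inj hA1').1, hA1]
  have Db : ∀ b, b ≠ k₁ → b ≠ k₁' → b ≠ k₂ → b ≠ k₂' → (D.1 b, D.2 b) = (T11.1 b, T11.2 b) := by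
    intro b hb1 hb1' hb2 hb2'
    show (T11.1 (c b), Dcl b) = _
    rw [hcb b hb1 hb1' hb2 hb2']; simp only [Dcl, if_neg hb1, if_neg hb1', if_neg hb2, if_neg hb2']
  -- presence of C and D: every cell is a cell of a present term
  have pres : ∀ (R S : Equiv.Perm (Fin m) × (Fin m → Fin K)) (b : Fin m), termSign ε S ≠ 0 →
      (R.1 b, R.2 b) = (S.1 b, S.2 b) → ε (R.1 b) b (R.2 b) ≠ 0 := by
    intro R S b hS h
    rw [(Prod.mk.inj h).1, (Prod.mk.inj h).2]; exact (termSign_ne_zero_iff ε S).1 hS b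
  have hCp : termSign ε C ≠ 0 := by
    rw [termSign_ne_zero_iff]; intro b
    by_cases hb1 : b = k₁
    · subst hb1; exact pres C T10 _ h10.1 Ck₁
    by_cases hb2 : b = k₂
    · subst hb2; exact pres C T01 _ h01.1 Ck₂
    · exact pres C T00 _ h00 (Cb b hb1 hb2)
  have hDp : termSign ε D ≠ 0 := by
    rw [termSign_ne_zero_iff]; intro b
    by_cases hb1 : b = k₁
    · subst hb1; exact pres D T01 _ h01.1 Dk₁
    by_cases hb1' : b = k₁'
    · subst hb1'; exact pres D T10 _ h10.1 Dk₁'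
    by_cases hb2 : b = k₂
    · subst hb2; exact pres D T10 _ h10.1 Dk₂
    by_cases hb2' : b = k₂'
    · subst hb2'; exact pres D T01 _ h01.1 Dk₂'
    · exact pres D T11 _ h11 (Db b hb1 hb1' hb2 hb2')
  -- C ≠ T01 (they differ at k₂')
  have hCne : C ≠ T01 := by
    intro h
    have := Cb k₂' h12'.symm h22'.symm
    rw [h] at this
    exact hdiff ((Prod.mk.inj this).1).symm
  -- incidence counts: column by column {T01, T10} = {C, D} as multisets
  let Ps : ℕ → Equiv.Perm (Fin m) × (Fin m → Fin K) := fun j => if j = 0 then T01 else T10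
  let Qs : ℕ → Equiv.Perm (Fin m) × (Fin m → Fin K) := fun j => if j = 0 then C else D
  let Qs' : ℕ → Equiv.Perm (Fin m) × (Fin m → Fin K) := fun j => if j = 0 then D else C
  let θs : ℕ → ℤ := fun j => if j = 0 then θ₀₁ else θ₁₀
  have key : ∀ (b : Fin m) (al : Fin m × Fin K),
      (if (T01.1 b, T01.2 b) = al then 1 else 0) + (if (T10.1 b, T10.2 b) = al then 1 else 0)
        = (if (C.1 b, C.2 b) = al then 1 else 0) + (if (D.1 b, D.2 b) = al then 1 else 0) := by
    intro b al
    by_cases hb1 : b = k₁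
    · subst hb1; rw [Ck₁, Dk₁]; omega
    by_cases hb1' : b = k₁'
    · subst hb1'; rw [Cb _ h11'.symm h1'2, Dk₁', hB1]
    by_cases hb2 : b = k₂
    · subst hb2; rw [Ck₂, Dk₂]
    by_cases hb2' : b = k₂'
    · subst hb2'; rw [Cb _ h12'.symm h22'.symm, Dk₂', hB2]; omega
    · rw [Cb b hb1 hb2, Db b hb1 hb1' hb2 hb2']
      rcases hcol b hb1 hb1' hb2 hb2' with ⟨e1, e2⟩ | ⟨e1, e2⟩
      · rw [e1, e2]
      · rw [e1, e2]; omega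
  have hinc : ∀ (b : Fin m) (al : Fin m × Fin K),
      ((range 2).filter fun j => ((Ps j).1 b, (Ps j).2 b) = al).card =
        ((range 2).filter fun j => ((Qs j).1 b, (Qs j).2 b) = al).card := by
    intro b al; rw [BlockRematch.card_filter_range_two, BlockRematch.card_filter_range_two]
    simp only [Ps, Qs, if_true, one_ne_zero, if_false]; exact key b al
  have hinc' : ∀ (b : Fin m) (al : Fin m × Fin K),
      ((range 2).filter fun j => ((Ps j).1 b, (Ps j).2 b) = al).card =
        ((range 2).filter fun j => ((Qs' j).1 b, (Qs' j).2 b) = al).card := by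
    intro b al; rw [BlockRematch.card_filter_range_two, BlockRematch.card_filter_range_two]
    simp only [Ps, Qs', if_true, one_ne_zero, if_false]; rw [key b al]; omega
  have hθs : ∀ i, i + 1 < 2 → θs i ≤ θs (i + 1) := by
    intro i hi; have : i = 0 := by omega
    subst this; simp only [θs]; exact le_of_lt hθ
  have hPs : ∀ j, j < 2 → IsDominant d v ε (θs j) (Ps j) := by
    intro j hj; rcases Nat.lt_succ_iff.1 hj |> Nat.le_one_iff_eq_zero_or_eq_one.1 with rfl | rfl
    · simpa [Ps, θs] using h01
    · simpa [Ps, θs] using h10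
  -- slopes of C and D
  have hsC : slope d C = slope d T00 + ((d (T10.2 k₁) : ℤ) - d (T00.2 k₁)) + ((d (T01.2 k₂) : ℤ) - d (T00.2 k₂)) := by
    unfold TropicalCensus.slope
    rw [← Finset.add_sum_erase _ _ (Finset.mem_univ k₁), ← Finset.add_sum_erase _ _ (Finset.mem_univ k₁)]
    rw [← Finset.add_sum_erase _ _ (Finset.mem_erase.2 ⟨h12.symm, Finset.mem_univ k₂⟩),
      ← Finset.add_sum_erase _ _ (Finset.mem_erase.2 ⟨h12.symm, Finset.mem_univ k₂⟩)]
    have hrest : ∑ x ∈ (univ.erase k₁).erase k₂, (d (C.2 x) : ℤ) = ∑ x ∈ (univ.erase k₁).erase k₂, (d (T00.2 x) : ℤ) :=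
      Finset.sum_congr rfl fun x hx => by
        have hx2 : x ≠ k₂ := (Finset.mem_erase.1 hx).1
        have hx1 : x ≠ k₁ := (Finset.mem_erase.1 (Finset.mem_erase.1 hx).2).1
        rw [(Prod.mk.inj (Cb x hx1 hx2)).2]
    rw [hrest, (Prod.mk.inj Ck₁).2, (Prod.mk.inj Ck₂).2]; ring
  have hsD : slope d D = slope d T11 - (((d (T10.2 k₁) : ℤ) - d (T00.2 k₁)) + ((d (T01.2 k₂) : ℤ) - d (T00.2 k₂))) := by
    unfold TropicalCensus.slope
    have m1 : k₁ ∈ (univ : Finset (Fin m)) := Finset.mem_univ _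
    have m1' : k₁' ∈ (univ : Finset (Fin m)).erase k₁ := Finset.mem_erase.2 ⟨h11'.symm, Finset.mem_univ _⟩
    have m2 : k₂ ∈ ((univ : Finset (Fin m)).erase k₁).erase k₁' :=
      Finset.mem_erase.2 ⟨h1'2.symm, Finset.mem_erase.2 ⟨h12.symm, Finset.mem_univ _⟩⟩
    have m2' : k₂' ∈ (((univ : Finset (Fin m)).erase k₁).erase k₁').erase k₂ :=
      Finset.mem_erase.2 ⟨h22'.symm, Finset.mem_erase.2 ⟨h1'2'.symm, Finset.mem_erase.2 ⟨h12'.symm, Finset.mem_univ _⟩⟩⟩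
    rw [← Finset.add_sum_erase _ _ m1, ← Finset.add_sum_erase _ _ m1, ← Finset.add_sum_erase _ _ m1',
      ← Finset.add_sum_erase _ _ m1', ← Finset.add_sum_erase _ _ m2, ← Finset.add_sum_erase _ _ m2,
      ← Finset.add_sum_erase _ _ m2', ← Finset.add_sum_erase _ _ m2']
    have hrest : ∑ x ∈ (((univ.erase k₁).erase k₁').erase k₂).erase k₂', (d (D.2 x) : ℤ) =
        ∑ x ∈ (((univ.erase k₁).erase k₁').erase k₂).erase k₂', (d (T11.2 x) : ℤ) :=
      Finset.sum_congr rfl fun x hx => by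
        have hx2' : x ≠ k₂' := (Finset.mem_erase.1 hx).1
        have hx' := (Finset.mem_erase.1 hx).2
        have hx2 : x ≠ k₂ := (Finset.mem_erase.1 hx').1
        have hx'' := (Finset.mem_erase.1 hx').2
        have hx1' : x ≠ k₁' := (Finset.mem_erase.1 hx'').1
        have hx1 : x ≠ k₁ := (Finset.mem_erase.1 (Finset.mem_erase.1 hx'').2).1
        rw [(Prod.mk.inj (Db x hx1 hx1' hx2 hx2')).2]
    rw [hrest, (Prod.mk.inj Dk₁).2, (Prod.mk.inj Dk₁').2, (Prod.mk.inj Dk₂).2, (Prod.mk.inj Dk₂').2, hc1, hB1c, hc2, hB2c,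
      (Prod.mk.inj hA1').2, hB1d, (Prod.mk.inj hA2').2, hB2d]
    ring
  -- the multi-exchange law, both orders
  constructor
  · obtain ⟨j, hj, hlt⟩ := MultiExchange.prefix_deficit d v ε 2 θs Ps Qs hθs hPs
      (by intro j hj; rcases Nat.lt_succ_iff.1 hj |> Nat.le_one_iff_eq_zero_or_eq_one.1 with rfl | rfl
          · simpa [Qs] using hCp
          · simpa [Qs] using hDp)
      ⟨0, by norm_num, by simpa [Ps, Qs] using hCne⟩ hinc
    have hj0 : j = 0 := by omega
    subst hj0
    simp only [zero_add, Finset.range_one, Finset.sum_singleton, Ps, Qs, if_true] at hlt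
    have : slope d T01 < slope d C := hlt
    rw [hsC] at this; exact this
  · -- D ≠ T01?  If D = T01 the conclusion still follows from the first order unless …; we use C ≠ T10 instead at index 1
    have hCne' : ∃ j, j < 2 ∧ Qs' j ≠ Ps j := by
      by_cases hD : D = T01
      · refine ⟨1, by norm_num, ?_⟩
        simp only [Qs', Ps, one_ne_zero, if_false]
        intro h
        -- C = T10 and D = T01 would make {T01,T10} = {C,D} termwise; then slope C = slope T10 > slope T01 — fine, but we need Q ≠ P:
        -- C = T10 forces T10's cell at k₂' to be T00's, i.e. (T00.1 k₂', _) = (T10.1 k₂', _) — true by hB2; so derive the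
        -- contradiction from D = T01 at column k₁': D's cell there is T10's (row T00.1 k₁), T01's is T00's cell at k₁'.
        have e1 := Dk₁'
        rw [hD, hB1] at e1
        -- so T00's cell at k₁' equals T10's cell at k₁', whose row is T00.1 k₁: then T00.1 k₁' = T00.1 k₁, contradiction k₁ ≠ k₁'
        have : T00.1 k₁' = T00.1 k₁ := by rw [(Prod.mk.inj e1).1, hB1a]
        exact h11' (T00.1.injective this).symm
      · exact ⟨0, by norm_num, by simpa [Qs', Ps] using hD⟩
    obtain ⟨j, hj, hlt⟩ := MultiExchange.prefix_deficit d v ε 2 θs Ps Qs' hθs hPs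
      (by intro j hj; rcases Nat.lt_succ_iff.1 hj |> Nat.le_one_iff_eq_zero_or_eq_one.1 with rfl | rfl
          · simpa [Qs'] using hDp
          · simpa [Qs'] using hCp)
      hCne' hinc'
    have hj0 : j = 0 := by omega
    subst hj0
    simp only [zero_add, Finset.range_one, Finset.sum_singleton, Ps, Qs', if_true] at hlt
    have : slope d T01 < slope d D := hlt
    rw [hsD] at this; exact this

/-- **DOUBLE-COUPLING NO-GO.**  In the setting of `window`, if the hole-cell excess `γ` is at most the fast step
`slope T01 − slope T00` or at least the slow step `slope T11 − slope T01`, the four terms cannot all be as assumed.  Both natural costings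
are covered: hole cells of the coupling class (`γ = 0 ≤` fast step, the fast step being positive along a dominant chain) and hole cells of
the registers' own classes with R1's class step equal to its slope step (`γ ≥` slow step). [this cell] -/
theorem nogo (d : Fin K → ℕ) (v ε : Fin m → Fin m → Fin K → ℤ)
    (T00 T01 T10 T11 : Equiv.Perm (Fin m) × (Fin m → Fin K)) {θ₀₁ θ₁₀ : ℤ} (hθ : θ₀₁ < θ₁₀)
    (h01 : IsDominant d v ε θ₀₁ T01) (h10 : IsDominant d v ε θ₁₀ T10) (h00 : termSign ε T00 ≠ 0) (h11 : termSign ε T11 ≠ 0)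
    (k₁ k₁' k₂ k₂' : Fin m) (h11' : k₁ ≠ k₁') (h12 : k₁ ≠ k₂) (h12' : k₁ ≠ k₂') (h1'2 : k₁' ≠ k₂) (h1'2' : k₁' ≠ k₂') (h22' : k₂ ≠ k₂')
    -- generic columns follow one register (or both)
    (hcol : ∀ b, b ≠ k₁ → b ≠ k₁' → b ≠ k₂ → b ≠ k₂' →
      ((T01.1 b, T01.2 b) = (T00.1 b, T00.2 b) ∧ (T10.1 b, T10.2 b) = (T11.1 b, T11.2 b)) ∨
      ((T01.1 b, T01.2 b) = (T11.1 b, T11.2 b) ∧ (T10.1 b, T10.2 b) = (T00.1 b, T00.2 b)))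
    -- column k₁ (R1's hole column at x): couplings for T00, T01 (same class); Case-A hole cell for T10 = T11 with row T00.1 k₂
    (hA1 : T10.1 k₁ = T00.1 k₂) (hA1' : (T11.1 k₁, T11.2 k₁) = (T10.1 k₁, T10.2 k₁)) (hc1 : T01.2 k₁ = T00.2 k₁)
    -- column k₂ (R2's hole column at u): couplings for T00, T10; Case-A hole cell for T01 = T11 with row T00.1 k₁
    (hA2 : T01.1 k₂ = T00.1 k₁) (hA2' : (T11.1 k₂, T11.2 k₂) = (T01.1 k₂, T01.2 k₂)) (hc2 : T10.2 k₂ = T00.2 k₂)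
    -- column k₁' (R1's hole column at y): T00 = T01 there; T10, T11 carry the couplings from R2's row holes
    (hB1 : (T01.1 k₁', T01.2 k₁') = (T00.1 k₁', T00.2 k₁')) (hB1a : T10.1 k₁' = T00.1 k₁) (hB1b : T11.1 k₁' = T01.1 k₁)
    (hB1c : T10.2 k₁' = T00.2 k₁) (hB1d : T11.2 k₁' = T00.2 k₁)
    -- column k₂' (R2's hole column at v): T00 = T10 there; T01, T11 carry the couplings from R1's row holes
    (hB2 : (T10.1 k₂', T10.2 k₂') = (T00.1 k₂', T00.2 k₂')) (hB2a : T01.1 k₂' = T00.1 k₂) (hB2b : T11.1 k₂' = T10.1 k₂)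
    (hB2c : T01.2 k₂' = T00.2 k₂) (hB2d : T11.2 k₂' = T00.2 k₂)
    (hdiff : T00.1 k₂' ≠ T01.1 k₂')
    (hγ : ((d (T10.2 k₁) : ℤ) - d (T00.2 k₁)) + ((d (T01.2 k₂) : ℤ) - d (T00.2 k₂)) ≤ slope d T01 - slope d T00 ∨
      slope d T11 - slope d T01 ≤ ((d (T10.2 k₁) : ℤ) - d (T00.2 k₁)) + ((d (T01.2 k₂) : ℤ) - d (T00.2 k₂))) : False := by
  obtain ⟨h1, h2⟩ := window d v ε T00 T01 T10 T11 hθ h01 h10 h00 h11 k₁ k₁' k₂ k₂' h11' h12 h12' h1'2 h1'2' h22' hcol hA1 hA1' hc1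
    hA2 hA2' hc2 hB1 hB1a hB1b hB1c hB1d hB2 hB2a hB2b hB2c hB2d hdiff
  rcases hγ with h | h <;> linarith

end DoubleCoupling

end Summit.ValiantsHypothesis.ValiantsHypothesis.Theorems.KPlusLogSqLaw
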